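import Mathlib
import HarnessLib
import Literature.NumberTheory.LFunctions.ZetaScrew
import Summits.RiemannHypothesis.RiemannHypothesis.Theorems.IntegerScrewDefs
import Summits.RiemannHypothesis.RiemannHypothesis.Theorems.IntegerScrewNestedSylvester
import Summits.RiemannHypothesis.RiemannHypothesis.Theorems.IntegerScrewPivotCriterion
import Summits.RiemannHypothesis.RiemannHypothesis.Theorems.IntegerScrewPivotUpperBound
import Summits.RiemannHypothesis.RiemannHypothesis.Theorems.IntegerScrewRungThree
import Summits.RiemannHypothesis.RiemannHypothesis.Theorems.IntegerScrewRungFour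

/-!
# Route `IntegerScrew` — the BASE/TAIL form of the pivot criterion: `RH ⟺ ∀ M ≥ 5, d_M > 0`

The barrier statement of HOME/pivot/PIVOT-LAW.md §9.5 P-T3 in kernel form. For every cut `M₀`,
`RH ⟺ (d_M > 0 for 2 ≤ M < M₀) ∧ (d_M > 0 for M ≥ M₀)` (`riemannHypothesis_iff_base_and_tail`), so
GIVEN a certified base the tail alone is RH (`tail_iff_riemannHypothesis_of_base`). With the RH-free
rungs `d_2, d_3, d_4 > 0` now in the tree (`screwPivot_two_pos`, `IntegerScrewRungThree`,
`IntegerScrewRungFour`) this gives **`riemannHypothesis_iff_screwPivot_pos_five : RH ⟺ ∀ M ≥ 5, d_M > 0`**.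
Finally `zetaScrew_log_pos_of_screwPivot_pos`: the full ladder forces `Ψ(log M) > 0` for every `M ≥ 2`
(via `d_M ≤ 2Ψ(log M)`, `IntegerScrewPivotUpperBound`) — the diagonal statement whose «for all M»
version is itself RH (`DiscreteLandau`). Nothing here bears on the truth of RH: these are
re-packagings of the RH-EQUIVALENCE with a finite, kernel-certified base. Reference for the objects:
M. Suzuki, J. Lond. Math. Soc. (2) 108 (2023) = arXiv:2206.03682 [Suzuki2023].
-/

noncomputable section

-- D-0017: `Summit.<S>.<S>.…` is the designed namespace of a single-problem summit.
set_option linter.dupNamespace false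

namespace Summit.RiemannHypothesis.RiemannHypothesis.Theorems.IntegerScrew

open Literature.NumberTheory.LFunctions

/-- **Base/tail split of the pivot criterion (the «barrier statement» of HOME/pivot/PIVOT-LAW.md §9.5
P-T3, kernel form).** For every cut `M₀`: RH holds iff the finitely many rungs `d_M > 0, 2 ≤ M < M₀`
hold AND the tail `d_M > 0, M ≥ M₀` holds. The first conjunct is a finite computation (a certified
ladder); the tail conjunct, given the base, is therefore exactly as hard as RH. [folklore] -/
theorem riemannHypothesis_iff_base_and_tail (M₀ : ℕ) :
    _root_.RiemannHypothesis ↔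
      (∀ M : ℕ, 2 ≤ M → M < M₀ → 0 < screwPivot M) ∧ (∀ M : ℕ, M₀ ≤ M → 2 ≤ M → 0 < screwPivot M) := by
  rw [riemannHypothesis_iff_screwPivot_pos]
  constructor
  · intro h
    exact ⟨fun M hM _ => h M hM, fun M _ hM => h M hM⟩
  · rintro ⟨hb, ht⟩ M hM
    rcases lt_or_ge M M₀ with h | h
    · exact hb M hM h
    · exact ht M h hM

/-- Given a certified base `d_2, …, d_{M₀−1} > 0`, the tail statement `∀ M ≥ M₀, d_M > 0` is
EQUIVALENT to RH. [folklore] -/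
theorem tail_iff_riemannHypothesis_of_base (M₀ : ℕ)
    (hbase : ∀ M : ℕ, 2 ≤ M → M < M₀ → 0 < screwPivot M) :
    (∀ M : ℕ, M₀ ≤ M → 2 ≤ M → 0 < screwPivot M) ↔ _root_.RiemannHypothesis := by
  rw [riemannHypothesis_iff_base_and_tail M₀]
  exact ⟨fun h => ⟨hbase, h⟩, fun h => h.2⟩

/-- **RH ⟺ every pivot from the fifth on is positive**: the base `d_2, d_3, d_4 > 0` is discharged
in the kernel (`screwPivot_two_pos`, `screwPivot_three_pos`, `screwPivot_four_pos`), so the whole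
content of RH for this route is the tail `∀ M ≥ 5, d_M > 0`. [folklore] -/
theorem riemannHypothesis_iff_screwPivot_pos_five :
    _root_.RiemannHypothesis ↔ ∀ M : ℕ, 5 ≤ M → 0 < screwPivot M := by
  rw [← tail_iff_riemannHypothesis_of_base 5 (fun M h2 h5 => ?_)]
  · exact ⟨fun h M hM => h M hM (by omega), fun h M hM _ => h M hM⟩
  · interval_cases M
    · exact screwPivot_two_pos
    · exact screwPivot_three_pos
    · exact screwPivot_four_pos

/-- Under the tail's failure, the failure is VISIBLE on the diagonal: if all rungs below `M` hold and
`d_M ≤ 0` fails to be positive… stated positively: along any ladder `d_2, …, d_{N+1} > 0` every diagonal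
value `Ψ(log M)`, `2 ≤ M ≤ N + 2`, is at least `d_M/2`; in particular the full tail forces
`Ψ(log M) > 0` for every `M ≥ 2` (the RH-equivalent diagonal statement of `DiscreteLandau`). [folklore] -/
theorem zetaScrew_log_pos_of_screwPivot_pos (h : ∀ M : ℕ, 2 ≤ M → 0 < screwPivot M) (M : ℕ)
    (hM : 2 ≤ M) : 0 < zetaScrew (Real.log M) := by
  have hpd : ∀ n, (screwMatrix n).PosDef :=
    (screwMatrix_posDef_iff_screwPivot_pos).mpr h
  have hle := screwPivot_le_two_zetaScrew_log M hM (hpd (M - 2))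
  have hpos := h M hM
  linarith

end Summit.RiemannHypothesis.RiemannHypothesis.Theorems.IntegerScrew
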